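import Literature.NumberTheory.GaloisRepresentations.TateDualLimitDualConditionLevels
import Literature.NumberTheory.GaloisRepresentations.UnramifiedSubgroupMapSurjective
import Literature.NumberTheory.GaloisRepresentations.UnramifiedClassesInertia
import HarnessLib

/-!
# `S_{𝓛*}(K, T*)` read levelwise off `Σ`: the unramified condition (Greenberg 2010 §3.1; theorems only)

Topic `NumberTheory/GaloisRepresentations`; namespaces `Literature.NumberTheory.GaloisRepresentations`
(§1) and `….DiscreteGaloisModule.TorsionLayers` (§2).  THEOREMS ONLY (no definition, no named fact, no
`sorry`, no instance).  Lane «SUR-Λ» of cell `bsd-eis` (road memo `SUR-LAMBDA-ROAD-w5g9.md` §2 ★(ε), brick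
C6 final part 2), `--supports stmt-BirchSwinnertonDyer-19032`.

MATHEMATICS (R. Greenberg, Kyoto J. Math. 50 (2010), §3.1 p. 14; J. S. Milne, *Arithmetic Duality
Theorems*, I §2 and Thm. 2.6): Greenberg's `S_{𝓛*}(K, T*)` lives in `H¹(K_Σ/K, T*)`, i.e. consists of
classes UNRAMIFIED at the finite places `w ∉ Σ`.  The tree's `Λ`-adic model (`CompactDualSelmer.lean`
of the Greenberg-2016 dictionary) phrases this as `loc_w y ∈ (H¹_ur(K_w, D))^⊥` for the `Λ`-adic local
pairing, while the finite-level Poitou–Tate arguments see the components `y_k = H¹(proj_k) y` and ask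
`loc_w y_k ∈ H¹_ur(K_w, Hom(D_k, μ_{p^k}))`.  The two agree when `D` is unramified at `w ∤ p`:

* §1 **`galoisCohomology.mem_unramifiedSubgroup_of_map_mem_of_injective`** (any non-archimedean local
  field `F`): for an INJECTIVE equivariant `f : W → W'` of discrete `Γ_F`-modules with the inertia
  group acting trivially on `W'`, a class whose image under `H¹(f)` is unramified is unramified
  (`H¹(I_F, W) = Hom(I_F, W) ↪ Hom(I_F, W')`; the tree's
  `oneCocycleClass_mem_unramifiedSubgroup_iff_forall_eq_zero`); `comap_map_unramifiedSubgroup_eq`.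
* §2 for a torsion tower `E` of `D` unramified at `w`: `comap_localSubtypeMap_unramifiedSubgroup` —
  `((D_k ⊆ D)_*)⁻¹ H¹_ur(K_w, D) = H¹_ur(K_w, D_k)`; and **`locDual_mem_dualLocalCondition_unramified_iff`**
  — for a family `inv` with the level-change law at `w` and Milne I 2.6 at every level
  (`LocalInvariants.UnramifiedOrthogonal`; the tree's `unramifiedOrthogonal_of_isPerfect_allLevels` for
  the canonical family), `p ∉ w`:
  `loc_w Y ∈ (H¹_ur(K_w, D))^⊥ ↔ ∀ k, loc_w (Y_k) ∈ H¹_ur(K_w, Hom(D_k, μ_{p^k}))`.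

HONESTY: bookkeeping between two currencies of the tree; nothing of Greenberg's propositions or of BSD
is proved here.  AI formalisation, weaker than expert review; the statements are established only by
the kernel check.

## References
* R. Greenberg, *Surjectivity of the global-to-local map defining a Selmer group*, Kyoto J. Math.
  50 (2010) 853–888, §3.1 p. 14 (`S_{𝓛*}(K, T*) ⊆ H¹(K_Σ/K, T*)`). [Greenberg2010]
* J. S. Milne, *Arithmetic Duality Theorems*, 2nd ed. (2006), Ch. I §2, Thm. 2.6. [MilneADT2006]
-/

noncomputable section

open Function CategoryTheory NumberField IsDedekindDomain Field
open _root_.TopRep _root_.ContRepresentation _root_.ContinuousCohomology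
open scoped ContRepresentation
open Literature.NumberTheory.GaloisRepresentations.DiscreteGaloisModule
open Literature.NumberTheory.GaloisCohomology (LocalInvariants)

namespace Literature.NumberTheory.GaloisRepresentations

/-! ### §1. Injective equivariant maps reflect unramified classes -/

section Local

variable {F : Type} [Field F] [ValuativeRel F] [TopologicalSpace F] [IsNonarchimedeanLocalField F]
  {W W' : Type} [AddCommGroup W] [TopologicalSpace W] [DiscreteTopology W]
  [AddCommGroup W'] [TopologicalSpace W'] [DiscreteTopology W']
  {τ : DiscreteGaloisModule F W} {τ' : DiscreteGaloisModule F W'}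

/-- **An injective equivariant map reflects unramified classes** when the inertia group acts trivially
on the target: `H¹(f) x ∈ H¹_ur(F, W') ⟹ x ∈ H¹_ur(F, W)` (both conditions say the representing cocycle
vanishes on `I_F`, and `f` is injective). [cite: MilneADT2006, Ch. I §2 (unramified cohomology)] -/
theorem galoisCohomology.mem_unramifiedSubgroup_of_map_mem_of_injective
    (f : τ.toContRepresentation →ⁱL τ'.toContRepresentation) (hf : Injective f)
    (hI : ∀ σ ∈ absInertia F, ∀ w : W', τ' σ w = w) {x : galoisCohomology τ 1}
    (hx : galoisCohomology.map f 1 x ∈ τ'.unramifiedSubgroup 1) : x ∈ τ.unramifiedSubgroup 1 := by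
  obtain ⟨φ, rfl⟩ := oneCocycleClass_surjective _ x
  have hIτ : ∀ σ ∈ absInertia F, ∀ w : W, τ σ w = w := fun σ hσ w =>
    hf ((f.isIntertwining σ w).trans (hI σ hσ (f w)))
  have hx' := (τ'.oneCocycleClass_mem_unramifiedSubgroup_iff_forall_eq_zero hI _).1
    ((galoisCohomology.map_one_oneCocycleClass f φ) ▸ hx)
  refine (τ.oneCocycleClass_mem_unramifiedSubgroup_iff_forall_eq_zero hIτ φ).2 fun σ hσ => ?_
  apply hf
  rw [map_zero]
  exact hx' σ hσ

/-- Hence `H¹(f)⁻¹ (H¹_ur(F, W')) = H¹_ur(F, W)` for such `f`. [cite: MilneADT2006, Ch. I §2 (unramified cohomology)] -/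
theorem galoisCohomology.comap_map_unramifiedSubgroup_eq
    (f : τ.toContRepresentation →ⁱL τ'.toContRepresentation) (hf : Injective f)
    (hI : ∀ σ ∈ absInertia F, ∀ w : W', τ' σ w = w) :
    (τ'.unramifiedSubgroup 1).comap (galoisCohomology.map f 1) = τ.unramifiedSubgroup 1 := by
  refine le_antisymm (fun x hx => ?_) fun x hx => ?_
  · exact galoisCohomology.mem_unramifiedSubgroup_of_map_mem_of_injective f hf hI hx
  · exact galoisCohomology.map_unramifiedSubgroup_le f ⟨x, hx, rfl⟩

end Local

/-! ### §2. The tower: `((D_k ⊆ D)_*)⁻¹ H¹_ur(K_w, D) = H¹_ur(K_w, D_k)` and the levelwise reading -/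

namespace DiscreteGaloisModule.TorsionLayers

variable {K : Type} [Field K] [NumberField K] {D : Type} [AddCommGroup D] [TopologicalSpace D]
  [DiscreteTopology D] {τ : DiscreteGaloisModule K D} {p : ℕ} (E : τ.TorsionLayers p)

/-- **`((D_k ⊆ D)_*)⁻¹ H¹_ur(K_w, D) = H¹_ur(K_w, D_k)`** at a finite place `w` where `D` is unramified.
[cite: MilneADT2006, Ch. I §2 (unramified cohomology)] [cite: Greenberg2010, §3.1 p. 14] -/
theorem comap_localSubtypeMap_unramifiedSubgroup {w : HeightOneSpectrum (𝓞 K)}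
    (hur : GaloisRep.IsUnramifiedAt w τ) (k : ℕ) :
    (unramifiedSubgroup (GaloisRep.toLocal w τ) 1).comap (E.localSubtypeMap (Sum.inr w) k) =
      unramifiedSubgroup (GaloisRep.toLocal w (E.layerRep k)) 1 :=
  galoisCohomology.comap_map_unramifiedSubgroup_eq
    (τ := GaloisRep.toLocal w (E.layerRep k)) (τ' := GaloisRep.toLocal w τ)
    ((E.layerSubtypeHom k).hom.restrictField (Place.Completion (Sum.inr w : Place K)))
    (fun _ _ h => Subtype.ext h)
    (fun _ hσ d => GaloisRep.toLocal_apply_eq_self_of_isUnramifiedAt τ hur hσ d)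

variable [∀ k, Finite (E.N k)] [NeZero p] {inv : ∀ k : ℕ, LocalInvariants K (p ^ k)}

/-- **Off `Σ`, `loc_w Y ∈ (H¹_ur(K_w, D))^⊥ ↔ every component `loc_w (Y_k)` is unramified** — for a
family `inv` with the level-change law at `w` and Milne I Thm. 2.6 at every level, `p ∉ w`, `D`
unramified at `w`. [cite: Greenberg2010, §3.1 p. 14] [cite: MilneADT2006, Ch. I, Thm. 2.6] -/
theorem locDual_mem_dualLocalCondition_unramified_iff [CompactSpace (absoluteGaloisGroup K)]
    {w : HeightOneSpectrum (𝓞 K)} (hinv : InvLevelLaw inv (Sum.inr w : Place K))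
    (hUO : ∀ k, (inv k).UnramifiedOrthogonal) (hp : ∀ k, ((p ^ k : ℕ) : 𝓞 K) ∉ w.asIdeal)
    (hur : GaloisRep.IsUnramifiedAt w τ) (Y : continuousCohomology 1 E.dualSystem.limitRep.toTopRep) :
    E.locDual (absGaloisRestrict K (Place.Completion (Sum.inr w : Place K))) Y ∈
        E.dualLocalCondition inv (Sum.inr w) (unramifiedSubgroup (GaloisRep.toLocal w τ) 1) ↔
      ∀ k : ℕ, galoisCohomology.localization ((E.layerRep k).tateDual (p ^ k)) (Sum.inr w) 1
          (cohomologyMap (E.dualSystem.projHom k) 1 Y) ∈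
        unramifiedSubgroup (GaloisRep.toLocal w ((E.layerRep k).tateDual (p ^ k))) 1 := by
  rw [locDual_mem_dualLocalCondition_iff hinv]
  refine forall_congr' fun k => ?_
  have hurk : GaloisRep.IsUnramifiedAt w (E.layerRep k) := fun 𝔓 h𝔓 σ hσ =>
    LinearMap.ext fun x => Subtype.ext (LinearMap.congr_fun (hur 𝔓 h𝔓 σ hσ) (x : D))
  rw [E.comap_localSubtypeMap_unramifiedSubgroup hur k,
    ((hUO k) (E.layerRep k) (fun x => E.pow_smul_eq_zero x) w (hp k) hurk).1]
  exact Iff.rfl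

end DiscreteGaloisModule.TorsionLayers

end Literature.NumberTheory.GaloisRepresentations
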